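import Literature.Geometry.Riemannian.RicciFlowScalarCurvatureEvolution
import Literature.Geometry.Riemannian.RicciFlowScalarCurvatureRegularity
import Literature.Geometry.Riemannian.FamilyLaplacianRegularity
import Literature.Geometry.Lorentzian.CoordFamilyRegularity
import Literature.Geometry.Lorentzian.EnergyCurrents
import HarnessLib

/-!
# `|∇R|²` and `|Ric|²` are smooth on space-time along a Ricci flow
(helpers `helper_hamiltonSmoothGradSq`, `helper_hamiltonSmoothRicciNormSq` of stub
`stub_gradientEstimates` of line `margerin-cone-hamilton-rails`, crux `EntropyRung.ChangGurskyYang`,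
item stmt-SmoothPoincare4-10834)

Pieces H1/H2 of Hamilton 1982, Thm. 11.1 / Lemma 17.4 (the gradient estimate for the scalar
curvature along a pinched Ricci flow on a closed 4-manifold): the weak maximum principle
(`weakMaximumPrinciple`, Topping 2006, Thm. 3.1.1) is applied to
`u = |∇R|²/R + N|E|² − ηR²`, whose hypothesis `u ∈ C^∞(M × [0, T'])` needs the joint regularity on
space-time of `|∇R|²_{g(t)}` and of `|Ric|²_{g(t)}` — Topping's standing convention of §1.2.3
("everything is smooth on space-time"), here PROVED for the tree's `IsRicciFlow` on `[0, T']`: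

* `helper_hamiltonSmoothGradSq` — `(x, t) ↦ |∇R|²(x, t)` is `C^∞` on `M × [0, T']`: `R` is `C^∞`
  on space-time (`IsRicciFlow.contMDiffOn_scalarCurvatureWith`) and the gradient square of a
  smooth space-time function along a smooth family is smooth
  (`IsContMDiffFamilyOn.contMDiffOn_gradSq`);
* `helper_hamiltonSmoothRicciNormSq` — `(x, t) ↦ |Ric|²(x, t)` is `C^∞` on `M × [0, T']`: in the
  chart at `x` the function is `normSqAt (G t) y (ricAt (G t) y)` for the chart components
  `G = chartRep I g x` of the flow (`normSqAt_chartRep_ricAt_eq`: naturality of `Ric` and of the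
  metric square norm under the inverse chart, O'Neill 1983, Prop. 3.59), jointly smooth by
  `contDiffOn_normSqAt_family` / `IsMetricFamilyOn.contDiffOn_ricAt_family` — the template
  `IsRicciFlow.contMDiffOn_curvNormSqWith` of `CurvatureNormSq.lean` with `|Ric|²` for `|Rm|²`.

Everything is proved (no `Prop` definitions, no named facts); the general statements
(`isRicciFlow_contMDiffOn_gradSq_scalarCurvatureWith`, `isRicciFlow_contMDiffOn_normSq_ricci`)
hold on any manifold with boundaryless finite-dimensional model.

## References

* R. S. Hamilton, *Three-manifolds with positive Ricci curvature*, J. Differential Geom. 17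
  (1982) 255–306, §11 Thm. 11.1, §17 Lemma 17.4. [Hamilton1982]
* P. Topping, *Lectures on the Ricci flow*, LMS Lecture Note Series 325, CUP 2006, §1.2.3,
  Thm. 3.1.1. [Topping2006]
* B. O'Neill, *Semi-Riemannian geometry with applications to relativity*, Academic Press 1983,
  Ch. 3, Prop. 3.59, pp. 60–61. [ONeill1983]
-/

noncomputable section

-- every `Summit.SmoothPoincare4.SmoothPoincare4.…` name repeats the summit = sub-problem segment (D-0017 layout)
set_option linter.dupNamespace false
-- nested operator spaces of metric components (`E →L E →L ℝ` and their flips)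
set_option maxSynthPendingDepth 3

open Set Function Filter
open scoped Manifold ContDiff Topology

namespace Summit.SmoothPoincare4.SmoothPoincare4.Theorems.MargerinRails

open Literature.Geometry.Riemannian
open Literature.Geometry.Lorentzian Literature.Geometry.Lorentzian.PseudoRiemannianMetric

/-! ### Chart level: the metric square norm along a smooth family of components -/

section Coord

variable {E : Type*} [NormedAddCommGroup E] [NormedSpace ℝ E] [FiniteDimensional ℝ E]
  [CompleteSpace E] {G : ℝ → E → E →L[ℝ] E →L[ℝ] ℝ} {S : Set ℝ} {V : Set E}

/-- **The metric square norm along a smooth family is jointly smooth**: for a field of bilinear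
forms `β : E × ℝ → (E →L E →L ℝ)`, `C^∞` on `V × S`, `(y, t) ↦ |β(y,t)|²_{G t}(y)` is `C^∞` on
`V × S` (`|β|² = tr ((♯∘β) ∘ (♯∘βᵗ))`, `♯` jointly smooth: `contDiffOn_sharpAt_family`; companion
of the tree's `IsMetricFamilyOn.contDiffOn_mtrAt_family`). [cite: Topping2006, §1.2.3] -/
theorem contDiffOn_normSqAt_family (hG : MetricCoord.IsMetricFamilyOn G S V)
    {β : E × ℝ → E →L[ℝ] E →L[ℝ] ℝ} (hβ : ContDiffOn ℝ ∞ β (V ×ˢ S)) :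
    ContDiffOn ℝ ∞ (fun q : E × ℝ ↦ MetricCoord.normSqAt (G q.2) q.1 (β q)) (V ×ˢ S) := by
  simp only [MetricCoord.normSqAt_eq_traceCLM]
  have hflip : ContDiffOn ℝ ∞ (fun q ↦ (β q).flip) (V ×ˢ S) :=
    (ContinuousLinearMap.flipₗᵢ ℝ E E ℝ).contDiff.comp_contDiffOn hβ
  exact (MetricCoord.traceCLM E).contDiff.comp_contDiffOn
    ((hG.contDiffOn_sharpAt_family.clm_comp hβ).clm_comp
      (hG.contDiffOn_sharpAt_family.clm_comp hflip))

/-- **`|Ric|²` of a smooth family of components is jointly smooth**: `(y, t) ↦ |Ric(G t)|²_{G t}(y)`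
is `C^∞` on `V × S` (`contDiffOn_normSqAt_family` with `IsMetricFamilyOn.contDiffOn_ricAt_family`).
[cite: Topping2006, §1.2.3] -/
theorem contDiffOn_normSqAt_ricAt_family (hG : MetricCoord.IsMetricFamilyOn G S V) :
    ContDiffOn ℝ ∞ (fun q : E × ℝ ↦ MetricCoord.normSqAt (G q.2) q.1 (MetricCoord.ricAt (G q.2) q.1))
      (V ×ˢ S) :=
  contDiffOn_normSqAt_family hG hG.contDiffOn_ricAt_family

end Coord

/-! ### Manifold level: `|∇R|²` and `|Ric|²` along a Ricci flow -/

section General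

variable {E : Type*} [NormedAddCommGroup E] [NormedSpace ℝ E] [FiniteDimensional ℝ E]
  [CompleteSpace E] {H : Type*} [TopologicalSpace H] {I : ModelWithCorners ℝ E H} [I.Boundaryless]
  {M : Type*} [TopologicalSpace M] [ChartedSpace H M] [IsManifold I ∞ M]
  {g : ℝ → PseudoRiemannianMetric I ∞ E (TangentSpace I : M → Type _)}
  {cov : ℝ → CovariantDerivative I E (TangentSpace I : M → Type _)} {T : ℝ}

/-- **`|∇R|²` is `C^∞` on space-time along a Ricci flow on `[0, T]`, `T > 0`**: `R` is `C^∞` on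
`M × [0, T]` (`IsRicciFlow.contMDiffOn_scalarCurvatureWith`) and the gradient square of a smooth
space-time function along the smooth family `g` is smooth on space-time
(`IsContMDiffFamilyOn.contMDiffOn_gradSq`). [cite: Topping2006, §1.2.3] -/
theorem isRicciFlow_contMDiffOn_gradSq_scalarCurvatureWith (hflow : IsRicciFlow g cov (Icc 0 T))
    (hT : 0 < T) :
    ContMDiffOn (I.prod 𝓘(ℝ, ℝ)) 𝓘(ℝ, ℝ) ∞
      (fun p : M × ℝ ↦ (g p.2).gradSq (fun y ↦ (g p.2).scalarCurvatureWith (cov p.2) y) p.1)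
      (univ ×ˢ Icc 0 T) :=
  hflow.smooth.contMDiffOn_gradSq (uniqueDiffOn_Icc hT)
    (f := fun t y ↦ (g t).scalarCurvatureWith (cov t) y) hflow.contMDiffOn_scalarCurvatureWith

/-- **`|Ric|²` of the flow read in the chart**: for the Levi-Civita witness `cov t` of the flow,
`normSqAt (G t) u (ricAt (G t) u) = |Ric(g t)|²(Φ u)` at every point `u` of the chart target at
`x₀` (`G = chartRep I g x₀`, `Φ = chartInv I x₀`; `OpensChart.normSq_ricci_eq_normSqAt`,
`normSq_chartPullback_eq`, `ricci_comap_apply`, `IsLeviCivita.ricci_eq_ricci`).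
[cite: ONeill1983, Ch. 3, Prop. 3.59] -/
theorem normSqAt_chartRep_ricAt_eq (hflow : IsRicciFlow g cov (Icc 0 T)) (x₀ : M) {t : ℝ}
    (ht : t ∈ Icc 0 T) (u : chartTarget I x₀) :
    MetricCoord.normSqAt (chartRep I g x₀ t) u (MetricCoord.ricAt (chartRep I g x₀ t) u) =
      (g t).normSq (chartInv I x₀ u) ((cov t).ricci (chartInv I x₀ u)) := by
  haveI := (g t).hasLeviCivita
  haveI := (chartPullback I (g t) x₀).hasLeviCivita
  have h2 : (2 : ℕ∞ω) ≤ ∞ := WithTop.coe_le_coe.mpr le_top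
  have hG := val_chartPullback_eq_chartRep g x₀ t
  rw [← Literature.Geometry.Lorentzian.OpensChart.normSq_ricci_eq_normSqAt hG u,
    normSq_chartPullback_eq (g t) x₀ u _ ((g t).ricci (chartInv I x₀ u))
      (fun v w ↦ (g t).ricci_comap_apply contMDiff_pullbackBilin_holds (contMDiff_chartInv x₀)
        (injective_mfderiv_chartInv x₀) rfl u v w),
    (hflow.isLeviCivita t ht).ricci_eq_ricci h2]

/-- **`|Ric|²` is `C^∞` on space-time along a Ricci flow on `[0, T]`, `T > 0`** (Topping 2006,
§1.2.3: the curvature of a smooth family is smooth on space-time): in the chart at `x` the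
function is `normSqAt (G t) y (ricAt (G t) y)` for the chart components `G = chartRep I g x`
(`normSqAt_chartRep_ricAt_eq`), jointly smooth on `(chart target) × [0, T]` by
`contDiffOn_normSqAt_ricAt_family` for the family `IsRicciFlow.isMetricFamilyOn_chartRep` — the
proof of `IsRicciFlow.contMDiffOn_curvNormSqWith` with `|Ric|²` for `|Rm|²`. [cite: Topping2006, §1.2.3] -/
theorem isRicciFlow_contMDiffOn_normSq_ricci (hflow : IsRicciFlow g cov (Icc 0 T)) (hT : 0 < T) :
    ContMDiffOn (I.prod 𝓘(ℝ, ℝ)) 𝓘(ℝ, ℝ) ∞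
      (fun p : M × ℝ ↦ (g p.2).normSq p.1 ((cov p.2).ricci p.1)) (univ ×ˢ Icc 0 T) := by
  intro p hp
  obtain ⟨x, t⟩ := p
  have ht : t ∈ Icc 0 T := hp.2
  -- work in the chart at `x`
  set z := x
  have hfam : ContDiffOn ℝ ∞ (fun q : E × ℝ ↦ MetricCoord.normSqAt (chartRep I g z q.2) q.1
      (MetricCoord.ricAt (chartRep I g z q.2) q.1)) ((extChartAt I z).target ×ˢ Icc 0 T) :=
    contDiffOn_normSqAt_ricAt_family (hflow.isMetricFamilyOn_chartRep hT z)
  have hΦ : ContMDiffOn (I.prod 𝓘(ℝ, ℝ)) 𝓘(ℝ, E × ℝ) ∞ (fun p : M × ℝ ↦ (extChartAt I z p.1, p.2))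
      ((chartAt H z).source ×ˢ Icc 0 T) :=
    ((contMDiffOn_extChartAt (x := z)).comp contMDiffOn_fst fun p hp ↦ hp.1).prodMk_space
      contMDiffOn_snd
  have hmaps : MapsTo (fun p : M × ℝ ↦ (extChartAt I z p.1, p.2)) ((chartAt H z).source ×ˢ Icc 0 T)
      ((extChartAt I z).target ×ˢ Icc 0 T) := by
    intro p hp
    refine ⟨(extChartAt I z).map_source ?_, hp.2⟩
    rw [extChartAt_source]
    exact hp.1
  have hcomp := (contMDiffOn_iff_contDiffOn.2 hfam).comp hΦ hmaps
  have hnhds : (chartAt H z).source ×ˢ Icc 0 T ∈ 𝓝[univ ×ˢ Icc 0 T] ((x, t) : M × ℝ) := by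
    refine mem_nhdsWithin.mpr ⟨(chartAt H z).source ×ˢ univ,
      (chartAt H z).open_source.prod isOpen_univ, ⟨mem_chart_source H z, mem_univ _⟩, ?_⟩
    rintro q ⟨⟨hq1, -⟩, ⟨-, hq2⟩⟩
    exact ⟨hq1, hq2⟩
  have hxz : (x, t) ∈ (chartAt H z).source ×ˢ Icc 0 T := ⟨mem_chart_source H z, ht⟩
  refine ((hcomp.congr fun q hq ↦ ?_) (x, t) hxz).mono_of_mem_nhdsWithin hnhds
  -- the chart identity
  have hq1 : q.1 ∈ (chartAt H z).source := hq.1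
  have hy : extChartAt I z q.1 ∈ (extChartAt I z).target :=
    (extChartAt I z).map_source (by rw [extChartAt_source]; exact hq1)
  have hinv : chartInv I z ⟨extChartAt I z q.1, hy⟩ = q.1 :=
    (extChartAt I z).left_inv (by rw [extChartAt_source]; exact hq1)
  simp only [Function.comp_apply]
  rw [normSqAt_chartRep_ricAt_eq hflow z hq.2 ⟨extChartAt I z q.1, hy⟩, hinv]

end General

/-! ### The registered helper stubs (dimension four, `E = ℝ⁴`) -/

/-- **H1 — `|∇R|²` is jointly smooth on `M × [0, T']` along a Ricci flow** (Topping 2006, §1.2.3;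
the regularity hypothesis of the weak maximum principle, Thm. 3.1.1, in Hamilton 1982, Thm. 11.1):
`isRicciFlow_contMDiffOn_gradSq_scalarCurvatureWith` on a 4-manifold.
[cite: Topping2006, §1.2.3] [cite: Hamilton1982, Thm. 11.1] -/
theorem helper_hamiltonSmoothGradSq : ∀ (M : Type) [TopologicalSpace M] [T2Space M] [SecondCountableTopology M] [ChartedSpace (EuclideanSpace ℝ (Fin 4)) M] [IsManifold (𝓡 4) ∞ M] (g : ℝ → PseudoRiemannianMetric (𝓡 4) ∞ (EuclideanSpace ℝ (Fin 4)) (TangentSpace (𝓡 4) : M → Type _)) (cov : ℝ → CovariantDerivative (𝓡 4) (EuclideanSpace ℝ (Fin 4)) (TangentSpace (𝓡 4) : M → Type _)) (T' : ℝ), 0 < T' → IsRicciFlow g cov (Icc 0 T') → ContMDiffOn ((𝓡 4).prod 𝓘(ℝ, ℝ)) 𝓘(ℝ, ℝ) ∞ (fun p : M × ℝ ↦ (g p.2).gradSq (fun y ↦ (g p.2).scalarCurvatureWith (cov p.2) y) p.1) (univ ×ˢ Icc 0 T') := by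
  intro M _ _ _ _ _ g cov T' hT' hflow
  exact isRicciFlow_contMDiffOn_gradSq_scalarCurvatureWith hflow hT'

/-- **H2 — `|Ric|²` is jointly smooth on `M × [0, T']` along a Ricci flow** (Topping 2006, §1.2.3;
the regularity hypothesis of the weak maximum principle, Thm. 3.1.1, in Hamilton 1982, Thm. 11.1):
`isRicciFlow_contMDiffOn_normSq_ricci` on a 4-manifold.
[cite: Topping2006, §1.2.3] [cite: Hamilton1982, Thm. 11.1] -/
theorem helper_hamiltonSmoothRicciNormSq : ∀ (M : Type) [TopologicalSpace M] [T2Space M] [SecondCountableTopology M] [ChartedSpace (EuclideanSpace ℝ (Fin 4)) M] [IsManifold (𝓡 4) ∞ M] (g : ℝ → PseudoRiemannianMetric (𝓡 4) ∞ (EuclideanSpace ℝ (Fin 4)) (TangentSpace (𝓡 4) : M → Type _)) (cov : ℝ → CovariantDerivative (𝓡 4) (EuclideanSpace ℝ (Fin 4)) (TangentSpace (𝓡 4) : M → Type _)) (T' : ℝ), 0 < T' → IsRicciFlow g cov (Icc 0 T') → ContMDiffOn ((𝓡 4).prod 𝓘(ℝ, ℝ)) 𝓘(ℝ, ℝ)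 ∞ (fun p : M × ℝ ↦ (g p.2).normSq p.1 ((cov p.2).ricci p.1)) (univ ×ˢ Icc 0 T') := by
  intro M _ _ _ _ _ g cov T' hT' hflow
  exact isRicciFlow_contMDiffOn_normSq_ricci hflow hT'

end Summit.SmoothPoincare4.SmoothPoincare4.Theorems.MargerinRails

end
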